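import Mathlib
import HarnessLib
import Summits.HubbardSuperconductivity.HubbardSuperconductivity.Theorems.KLProgrammePerturbedFermiCurveHigherDerivsFrame

/-!
# Route `KLProgramme` — the frame's Fermi-point map `γ = toLp ∘ k_F^K` in GRADED form `‖Dⁱγ‖ ≤ Dⁱ` (`1 ≤ i ≤ 4`) from PER-ORDER radius
# bounds (the shape `twoLegAngularG_of_curve_bounds` consumes), so that the sharp `u_K‴, u_K⁗` of `…HigherDerivsFrame` feed (E3g)

Cell `gate-hubbard-kl`, seat hubbard-kl-k3c3-p3 (g2; row «implicit-function / monotonicity route»).  p1b's reduction of the engine's (E3g)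
`TwoLegAngularG` (`…SplitTwoLegReductions.twoLegAngularG_of_curve_bounds`, `…TwoLegAngularOfMoments`) takes the curve
`γ(θ) = toLp 2 (klFermiPoint μ K θ)` with `γ ∈ C⁴` and ONE graded constant `‖Dⁱγ(θ)‖ ≤ Dⁱ`, `1 ≤ i ≤ 4`; p1b's own witness is the crude
`D = 20·D_u`, `D_u = 31104·B⁴/d⁴` (finding N-(E3g): growth `4^{8N}` per order).  This module decouples the graded packaging from the
bootstrap: §1 for ANY `D₀ ≥ 1`, `D ≥ 1` with `|u_K θ| ≤ D₀` and `|u_K^{(k)} θ| ≤ D₀·Dᵏ` (`1 ≤ k ≤ 4`) one has `‖Dⁱγ(θ)‖ ≤ (4·D₀·D)ⁱ`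
(Leibniz for `u•dir`, `‖Dⁿdir‖ ≤ 1`, `‖toLp‖ ≤ 2`); §2 the bridge from the `deriv`-tower bounds `R₁, …, R₄` of `…HigherDerivsFrame`
(`|u_K′| ≤ R₁, …, |u_K⁗| ≤ R₄`, `|u_K| ≤ π√2 ≤ 5`): any `D ≥ 1` with `R_k ≤ 5·Dᵏ` gives `‖Dⁱγ‖ ≤ (20·D)ⁱ` — with the SHARP `R₃ = O(1 + A₃)`,
`R₄ = O(1 + A₃ + A₄)` the choice `D ≍ 2^{N+1}` qualifies (`A₃ ≲ 4^{N+1} ≤ (2^{N+1})³`, `A₄ ≲ 16^{N+1} = (2^{N+1})⁴`), which is the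
growth the frozen `angBar … i ∝ 4^{i(N+1)}` was typed for.  Everything is PROVED; no definitions, nothing about the Hubbard model.
References: BGM 2006 §2.4 Lemma 2.1 (2.40) [cite: BenfattoGiulianiMastropietro2006]; HOME/prover-p1b/g5/E3-CERT-NOTE.md.
-/

noncomputable section

namespace Summit.HubbardSuperconductivity.HubbardSuperconductivity.Theorems.PerturbedFermiCurve

set_option linter.dupNamespace false -- summit = problem name (single-conjunct summit), D-0017

open Real Set Finset
open Literature.MathematicalPhysics.QuantumLattice Literature.MathematicalPhysics.QuantumLattice.BandSectorCounting
open Summit.HubbardSuperconductivity.HubbardSuperconductivity.Theorems.DispersionFlow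
open Summit.HubbardSuperconductivity.HubbardSuperconductivity.Theorems.KLRegimeSplit

section Curve

variable {a b : ℝ} (B : BandBounds a b) {K : TrigPolyC4v} {A : ℝ}
  (hA : ∀ p : Momentum, ∀ j ≤ 2, ‖iteratedFDeriv ℝ j (frameShift K) p‖ ≤ A) (hADt : 2 * A < B.Dtmin)
  {μ : ℝ} (hlo : a ≤ μ - A) (hhi : μ + A ≤ b)
include B hA hADt hlo hhi

/-! ## §1 Graded packaging from per-order radius bounds -/

/-- **Graded curve bound from per-order radius bounds.**  For a frame with the lineage's `C²` hypotheses, if at the angle `θ` the Fermi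
radius `u_K = perturbedFermiRadius δ_K μ` satisfies `|u_K θ| ≤ D₀` and `|u_K^{(k)} θ| ≤ D₀·Dᵏ` for `1 ≤ k ≤ 4` (`D₀, D ≥ 1`), then
`‖Dⁱ(θ ↦ toLp 2 (klFermiPoint μ K θ))‖ ≤ (4·D₀·D)ⁱ` for `1 ≤ i ≤ 4`. -/
theorem norm_iteratedFDeriv_fermiPointLp_le_graded {D₀ D θ : ℝ} (hD₀ : 1 ≤ D₀) (hD : 1 ≤ D)
    (h0 : |perturbedFermiRadius (fun p : Fin 2 → ℝ => -K.eval p) μ θ| ≤ D₀)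
    (hk : ∀ k : ℕ, 1 ≤ k → k ≤ 4 → |iteratedDeriv k (perturbedFermiRadius (fun p : Fin 2 → ℝ => -K.eval p) μ) θ| ≤ D₀ * D ^ k)
    {i : ℕ} (hi1 : 1 ≤ i) (hi4 : i ≤ 4) :
    ‖iteratedFDeriv ℝ i (fun θ : ℝ => (WithLp.toLp 2 (klFermiPoint μ K θ) : Momentum)) θ‖ ≤ (4 * D₀ * D) ^ i := by
  set u := perturbedFermiRadius (fun p : Fin 2 → ℝ => -K.eval p) μ with hudef
  set T := ((EuclideanSpace.equiv (Fin 2) ℝ).symm : (Fin 2 → ℝ) →L[ℝ] Momentum) with hT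
  have hγ : (fun θ : ℝ => (WithLp.toLp 2 (klFermiPoint μ K θ) : Momentum)) = T ∘ fun θ => u θ • dir θ := by
    funext ϑ; simp [hT, klFermiPoint, hudef]
  have hu4 : ContDiff ℝ 4 u := contDiff_klFermiRadius B hA hADt hlo hhi (m := 4)
  have hf4 : ContDiff ℝ 4 (fun θ => u θ • dir θ) := hu4.smul contDiff_dir
  rw [hγ, T.iteratedFDeriv_comp_left hf4.contDiffAt (by exact_mod_cast hi4)]
  refine (T.norm_compContinuousMultilinearMap_le _).trans ?_
  have hD0' : 0 ≤ D₀ := by linarith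
  have hD' : 0 ≤ D := by linarith
  -- every order `k ≤ 4` of `u` at `θ` is bounded by `D₀·Dᵏ`
  have hu_k : ∀ k ≤ 4, ‖iteratedFDeriv ℝ k u θ‖ ≤ D₀ * D ^ k := by
    intro k hk4
    rw [norm_iteratedFDeriv_eq_norm_iteratedDeriv, Real.norm_eq_abs]
    rcases Nat.eq_zero_or_pos k with rfl | hk1
    · rw [iteratedDeriv_zero, pow_zero, mul_one]; exact h0
    · exact hk k hk1 hk4
  -- Leibniz for `u • dir`
  have hL := norm_iteratedFDeriv_smul_le (N := ((4 : ℕ) : WithTop ℕ∞)) hu4 contDiff_dir θ (n := i) (by exact_mod_cast hi4)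
  have hterm : ∀ k ∈ range (i + 1), (i.choose k : ℝ) * ‖iteratedFDeriv ℝ k u θ‖ * ‖iteratedFDeriv ℝ (i - k) dir θ‖ ≤
      (i.choose k : ℝ) * (D₀ * D ^ k) := by
    intro k hk
    have hki : k ≤ i := Nat.lt_succ_iff.1 (mem_range.1 hk)
    calc (i.choose k : ℝ) * ‖iteratedFDeriv ℝ k u θ‖ * ‖iteratedFDeriv ℝ (i - k) dir θ‖
        ≤ (i.choose k : ℝ) * (D₀ * D ^ k) * 1 :=
          mul_le_mul (mul_le_mul_of_nonneg_left (hu_k k (hki.trans hi4)) (by positivity)) (norm_iteratedFDeriv_dir_le _ _)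
            (norm_nonneg _) (by positivity)
      _ = (i.choose k : ℝ) * (D₀ * D ^ k) := mul_one _
  have hsum : ∑ k ∈ range (i + 1), (i.choose k : ℝ) * (D₀ * D ^ k) = D₀ * (D + 1) ^ i := by
    rw [add_pow, mul_sum]
    refine sum_congr rfl fun k _ => ?_
    rw [one_pow, mul_one]; ring
  have hT2 : ‖T‖ ≤ 2 := norm_toLpCLM_le
  calc ‖T‖ * ‖iteratedFDeriv ℝ i (fun θ => u θ • dir θ) θ‖
      ≤ 2 * (D₀ * (D + 1) ^ i) :=
        mul_le_mul hT2 (hL.trans ((sum_le_sum hterm).trans hsum.le)) (norm_nonneg _) (by norm_num)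
    _ ≤ (4 * D₀ * D) ^ i := by
        -- `2·D₀·(D+1)^i ≤ 2·D₀·(2D)^i ≤ (4·D₀·D)^i` for `i ≥ 1`, `D₀, D ≥ 1`
        have h1 : (D + 1) ^ i ≤ (2 * D) ^ i := pow_le_pow_left₀ (by linarith) (by linarith) i
        obtain ⟨m, rfl⟩ : ∃ m, i = m + 1 := ⟨i - 1, by omega⟩
        have hX : 0 ≤ (2 * D) ^ (m + 1) := pow_nonneg (by linarith) _
        have h2D₀ : (2 : ℝ) * D₀ ≤ (2 * D₀) ^ (m + 1) := le_self_pow₀ (by linarith) (by omega)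
        have h2 : 2 * D₀ * (2 * D) ^ (m + 1) ≤ (4 * D₀ * D) ^ (m + 1) := by
          calc 2 * D₀ * (2 * D) ^ (m + 1) ≤ (2 * D₀) ^ (m + 1) * (2 * D) ^ (m + 1) := mul_le_mul_of_nonneg_right h2D₀ hX
            _ = (4 * D₀ * D) ^ (m + 1) := by rw [← mul_pow]; ring
        nlinarith

/-! ## §2 The bridge from the `deriv`-tower bounds of `…HigherDerivsFrame` -/

/-- **From `|u_K′| ≤ R₁, |u_K″| ≤ R₂, |u_K‴| ≤ R₃, |u_K⁗| ≤ R₄` to the graded curve bound**: if `D ≥ 1` dominates the per-order radius bounds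
in the graded sense `R₁ ≤ 5D`, `R₂ ≤ 5D²`, `R₃ ≤ 5D³`, `R₄ ≤ 5D⁴` (`|u_K| ≤ π√2 ≤ 5` is automatic), then
`‖Dⁱ(θ ↦ toLp 2 (klFermiPoint μ K θ))‖ ≤ (20·D)ⁱ` for `1 ≤ i ≤ 4` — the hypothesis `hD` of `twoLegAngularG_of_curve_bounds` with `D ↦ 20D`.
With the sharp `R₃ = O(1 + A₃)`, `R₄ = O(1 + A₃ + A₄)` (`abs_deriv_three/four_frameRadius_le`) the graded `D ≍ 2^{N+1}` qualifies. -/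
theorem norm_iteratedFDeriv_fermiPointLp_le_of_tower {D θ R₁ R₂ R₃ R₄ : ℝ} (hD : 1 ≤ D)
    (hR₁ : |deriv (perturbedFermiRadius (fun p : Fin 2 → ℝ => -K.eval p) μ) θ| ≤ R₁)
    (hR₂ : |deriv (deriv (perturbedFermiRadius (fun p : Fin 2 → ℝ => -K.eval p) μ)) θ| ≤ R₂)
    (hR₃ : |deriv (deriv (deriv (perturbedFermiRadius (fun p : Fin 2 → ℝ => -K.eval p) μ))) θ| ≤ R₃)
    (hR₄ : |deriv (deriv (deriv (deriv (perturbedFermiRadius (fun p : Fin 2 → ℝ => -K.eval p) μ)))) θ| ≤ R₄)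
    (h1 : R₁ ≤ 5 * D) (h2 : R₂ ≤ 5 * D ^ 2) (h3 : R₃ ≤ 5 * D ^ 3) (h4 : R₄ ≤ 5 * D ^ 4)
    {i : ℕ} (hi1 : 1 ≤ i) (hi4 : i ≤ 4) :
    ‖iteratedFDeriv ℝ i (fun θ : ℝ => (WithLp.toLp 2 (klFermiPoint μ K θ) : Momentum)) θ‖ ≤ (20 * D) ^ i := by
  set u := perturbedFermiRadius (fun p : Fin 2 → ℝ => -K.eval p) μ with hudef
  have h0 : |u θ| ≤ 5 := by
    have hpos : 0 < u θ := frameRadius_pos B hA hlo hhi θ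
    have hle : u θ ≤ π * Real.sqrt 2 := frameRadius_le B hA hlo hhi θ
    rw [abs_of_pos hpos]
    have hs : Real.sqrt 2 ≤ 3 / 2 := by
      rw [show (3 / 2 : ℝ) = Real.sqrt ((3 / 2) ^ 2) by rw [Real.sqrt_sq (by norm_num)]]
      exact Real.sqrt_le_sqrt (by norm_num)
    nlinarith [Real.pi_pos, Real.sqrt_nonneg 2, Real.pi_lt_d2]
  have e1 : iteratedDeriv 1 u θ = deriv u θ := by rw [iteratedDeriv_one]
  have e2 : iteratedDeriv 2 u θ = deriv (deriv u) θ := by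
    change iteratedDeriv (0 + 1 + 1) u θ = _
    rw [iteratedDeriv_succ, iteratedDeriv_succ, iteratedDeriv_zero]
  have e3 : iteratedDeriv 3 u θ = deriv (deriv (deriv u)) θ := by
    change iteratedDeriv (0 + 1 + 1 + 1) u θ = _
    rw [iteratedDeriv_succ, iteratedDeriv_succ, iteratedDeriv_succ, iteratedDeriv_zero]
  have e4 : iteratedDeriv 4 u θ = deriv (deriv (deriv (deriv u))) θ := by
    change iteratedDeriv (0 + 1 + 1 + 1 + 1) u θ = _
    rw [iteratedDeriv_succ, iteratedDeriv_succ, iteratedDeriv_succ, iteratedDeriv_succ, iteratedDeriv_zero]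
  have hk : ∀ k : ℕ, 1 ≤ k → k ≤ 4 → |iteratedDeriv k u θ| ≤ 5 * D ^ k := by
    intro k hk1 hk4
    interval_cases k
    · rw [e1, pow_one]; exact hR₁.trans h1
    · rw [e2]; exact hR₂.trans h2
    · rw [e3]; exact hR₃.trans h3
    · rw [e4]; exact hR₄.trans h4
  have h := norm_iteratedFDeriv_fermiPointLp_le_graded B hA hADt hlo hhi (D₀ := 5) (by norm_num) hD h0 hk hi1 hi4
  calc _ ≤ (4 * 5 * D) ^ i := h
    _ = (20 * D) ^ i := by norm_num

end Curve

end Summit.HubbardSuperconductivity.HubbardSuperconductivity.Theorems.PerturbedFermiCurve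

end
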